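import Literature.MathematicalPhysics.QuantumFieldTheory.Balaban1983to89.B8LeafModelZd3
import Literature.MathematicalPhysics.QuantumFieldTheory.Balaban1983to89.B8Prop6OfThm4
import Literature.MathematicalPhysics.QuantumFieldTheory.Balaban1983to89.B8Thm8Surviving

/-!
# `Balaban1983to89.B8LeafModelZd3Boundary` — [Balaban1985RegularSpaces] THEOREM 2 (p. 83) AND THEOREM 8 IN ITS SURVIVING FORM (p. 101) ARE
# FALSE ON THE `GFData3` PROTOTYPE `B8LeafModelZd3.zdGF3` AS INDEXED BY ALL OF `ZdIdx`: the Ω₀-BOUNDARY LAYER (pin hazard №6), companion of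
# `B8LeafModelZdBoundary.not_thm2Printed_zdGF`

statement-level skeleton of published theorems with citation tags; proofs where landed; nothing here is a claim about the
Yang–Mills mass gap

PDF held: `paper:balaban1985-cmp99-regular-spaces-gauge-fixing` (journal page = PDF page + 74); p. 77, pp. 82–83 (Theorem 2), p. 101 (Theorem 8).

WHY THIS FILE (cell `pub-ymgap`, seat `pub-ymgap-dag-n05-a` g5, KNIT seat of DAG node N05 = [B8]; count-neutral; a LOCATED NEGATIVE for the pin).
The re-typed leaf `B8LeafKnitRS.B8LeafRS` reads `t2 := B8.Thm2Printed` and `t8 := B8Thm8Surviving.Thm8SurvivingAt 1 B₁ B₂` on the B8 family of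
record `X.fam8R : I₂ → B8SectGH.GFData3`.  On the prototype `zdGF3` (gauge transformations carried by `Ω 0`, (1.36)/(1.62) read on the sides of the
plaquettes touching `Ω_j`) BOTH fail on the minimal member with an exterior site adjacent to `Ω 0` (`Ω 0 = {0}`, `k = 1`, `η = 1`, one level-0 tower,
no constraint bonds; data `U₀ = 1`, `U′ =` the pure gauge of `1` by `−1` at `e₀ ∉ Ω 0`, and for Theorem 8 the source `f = 0 ∈ R(U₀)` with
`|f|₍₋₂₎ = 0 < γ(α₀ + α₁)`): the hypotheses (1.33)/(1.34)/(1.35) hold for every `α₀, α₁ > 0`, every admissible `u` is `1` at `0` ((1.29) level 0)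
and at `e₀` (carried by `Ω 0`), so `(U′^{u⁻¹})_(0,e₀) = −1`, contradicting the (1.36)₁ ∕ (1.62) clause `‖(1/iη) log(U′^{u⁻¹})_(0,e₀)‖ ≤ B₁(α₀+α₁)η⁻¹`
(Theorem 8's surviving form asserts (1.62) OUTRIGHT) once `B₁(α₀ + α₁) ≤ 1/16` (`norm_cfgExp_sub_one_le`: `‖e^{iηA} − 1‖ ≤ 1/8 < 2 = ‖−1 − 1‖`).
CONSEQUENCE FOR THE PIN (desk note `B8-PIN-DESIGN-g5.md` §3): the family of record must be indexed by sequences with `Ω 0 = univ` (print p. 77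
«we admit the case where some domains Ω_j are equal to T_η»); `thm4Printed_zd3` / `prop3Printed_zd3` are NOT affected.

WHAT IS PROVED (kernel, 0 sorry, theorems only; two private helpers): **`not_thm2Printed_zdGF3`**, **`not_thm8SurvivingAt_zdGF3`** (every `γ > 0`,
every `B₁, B₂`, `d ≥ 2`, `L ≥ 1`).

HONEST SCOPE.  Statements about the TYPING of the prototype family (which members `ZdIdx` admits), not about Bałaban's theorems on his admissible
sequences (1.4) with his gauge group; nothing of print is refuted.  Count-neutral; N05 NOT discharged; nothing continuum / ℝ⁴ / OS / mass-gap /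
Clay.  Unit `pub-ymgap-dag-n05-a` (g5), 2026-08-26.
-/

noncomputable section

open NormedSpace

namespace Literature.MathematicalPhysics.QuantumFieldTheory.Balaban1983to89.B8LeafModelZd3Boundary

open Complex (I)
open MatrixLog B7Prop1Explicit B7Prop2Explicit B7Prop1Local B7Eq92Concrete
open B8Ineq132 (InAk BondTouches)
open B8Eq119TwistedAxial (Restr129 InAx restr129_level_zero)
open B8Eq184Proof (cfgExp)
open B8Lemma1NonAbelian (mulCfg)
open B8Eq140Level (SideTouches)
open B8Eq138LandauZd (logCfg inR138_zero)
open B8Prop3GaugeFixedKLevel (norm_cfgExp_sub_one_le)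
open B8LeafModelZd (ZdIdx)
open B8LeafModelZd3 (zdGF3)

-- `Site` alone could resolve to the torus sites of `Setup.lean`; re-export the `ℤ^d` sites of `B7Prop1Explicit`.
export B7Prop1Explicit (Site)

variable {d : ℕ}

section Algebra

variable {𝔸 : Type*} [CStarAlgebra 𝔸] [Nontrivial 𝔸]

/-- `‖−1 − 1‖ = 2` in a nontrivial C⋆-algebra. [folklore] -/
private theorem norm_neg_one_sub_one' : ‖(-1 : 𝔸) - 1‖ = 2 := by
  have h : (-1 : 𝔸) - 1 = -((2 : ℝ) • (1 : 𝔸)) := by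
    rw [two_smul]; abel
  rw [h, norm_neg, norm_smul, norm_one, mul_one, Real.norm_eq_abs, abs_of_pos (by norm_num : (0 : ℝ) < 2)]

omit [Nontrivial 𝔸] in
/-- `−1` is a unitary unit. [folklore] -/
private theorem neg_one_mem_unitaryUnits' : (-1 : 𝔸ˣ) ∈ unitaryUnits 𝔸 := by
  rw [mem_unitaryUnits, Units.val_neg, Units.val_one]
  exact Unitary.mem_iff.mpr ⟨by simp, by simp⟩

end Algebra

section Refutation

variable {𝔸 : Type} [CStarAlgebra 𝔸] [Nontrivial 𝔸]

/-- **THEOREM 2's typed sentence is FALSE on the `GFData3` prototype `zdGF3` indexed by all of `ZdIdx`** (`d ≥ 2`, `L ≥ 1`, any Hölder data `β`,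
`len`): the boundary-layer member/data of the module docstring refute it (the (1.36)₁ clause of `C136` at the exterior-adjacent bond).
[cite: Balaban1985RegularSpaces, Thm 2 p.83, (1.33)–(1.36) p.82, p.77 (bond convention; «Ω_j = T_η» admitted)] -/
theorem not_thm2Printed_zdGF3 (hd2 : 2 ≤ d) {L : ℕ} (hL : 1 ≤ L) (β : ℝ) (len : Site d → ℝ) :
    ¬ B8.Thm2Printed (fun i : ZdIdx d L => (zdGF3 𝔸 L β len i).toGFData) := by
  rintro ⟨B₁, B₂, c₁, -, -, hc₁, H⟩
  classical
  have hd0 : 0 < d := by omega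
  set μ₀ : Fin d := ⟨0, hd0⟩ with hμ₀
  set v : Site d := 0 with hv
  set c : Site d := e μ₀ with hc
  have hcv : c ≠ v := by
    intro h
    have := congrArg (fun x : Site d => x μ₀) h
    simp [hc, hv, e_apply] at this
  -- the minimal member
  let i₀ : ZdIdx d L :=
    { η := 1
      hη := one_pos
      k := 1
      hk := le_rfl
      Ω := fun j => {x | x = v ∧ j = 0}
      hΩ := fun j x hx => by simp at hx
      Λs := fun _ j => {x | x = v ∧ j = 0}
      Λb := fun _ _ => ∅
      hbox := fun m _ j _ c hc => by simp at hc
      hclass := fun m _ j _ c hc => by simp at hc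
      htower := by
        rintro j - y ⟨rfl, rfl⟩ x hx
        refine ⟨funext fun i => le_antisymm (hx i).2 (hx i).1, rfl⟩
      hpart := by
        rintro x ⟨rfl, -⟩
        exact ⟨0, Nat.zero_le _, v, ⟨rfl, rfl⟩, fun i => ⟨le_rfl, le_rfl⟩⟩ }
  -- the smallness parameters (`M = max B₁ 1` so that `B₁ ≤ 0` is covered too)
  set M : ℝ := max B₁ 1 with hM_def
  have hM : 0 < M := lt_of_lt_of_le one_pos (le_max_right _ _)
  set α : ℝ := min (c₁ / 2) (1 / (32 * M)) with hα_def
  have hα : 0 < α := lt_min (by linarith) (by positivity)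
  have hαc : α + α ≤ c₁ := by
    have : α ≤ c₁ / 2 := min_le_left _ _
    linarith
  have hαB : B₁ * (α + α) ≤ 1 / 16 := by
    have h1 : α ≤ 1 / (32 * M) := min_le_right _ _
    have h2 : M * α ≤ M * (1 / (32 * M)) := mul_le_mul_of_nonneg_left h1 hM.le
    have h3 : M * (1 / (32 * M)) = 1 / 32 := by field_simp
    have h4 : B₁ * (α + α) ≤ M * (α + α) := mul_le_mul_of_nonneg_right (le_max_left _ _) (by linarith)
    linarith
  -- the data: `U₀ = 1`, `U′` = pure gauge by `−1` at `c`
  set g : Site d → 𝔸ˣ := Function.update 1 c (-1) with hg_def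
  have hgc : g c = -1 := by simp [hg_def]
  have hgv : g v = 1 := by simp [hg_def, hcv.symm]
  have hgU : ∀ x, g x ∈ unitaryUnits 𝔸 := by
    intro x
    by_cases hx : x = c
    · rw [hx, hgc]; exact neg_one_mem_unitaryUnits'
    · rw [hg_def, Function.update_of_ne hx]; exact (unitaryUnits 𝔸).one_mem
  have hg1 : ∀ x, g x ∈ U1 𝔸 := fun x => unitaryUnits_le_U1 (hgU x)
  set U' : Site d → Fin d → 𝔸ˣ := gaugeAct g 1 with hU'_def
  have hU'u : ∀ x κ, U' x κ ∈ unitaryUnits 𝔸 := fun x κ =>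
    (unitaryUnits 𝔸).mul_mem ((unitaryUnits 𝔸).mul_mem (hgU x) (unitaryUnits 𝔸).one_mem) ((unitaryUnits 𝔸).inv_mem (hgU _))
  have hvc : v + e μ₀ = c := by simp [hv, hc]
  have hU'vc : U' v μ₀ = -1 := by
    simp only [hU'_def, gaugeAct, hvc, hgv, hgc, Pi.one_apply, one_mul, mul_one]
    exact inv_neg_one
  have h1u : ∀ x κ, (1 : Site d → Fin d → 𝔸ˣ) x κ ∈ unitaryUnits 𝔸 := fun _ _ => (unitaryUnits 𝔸).one_mem
  let U₀ : (zdGF3 𝔸 L β len i₀).Cfg := ⟨1, h1u⟩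
  let P : (zdGF3 𝔸 L β len i₀).Pert := (⟨1, h1u⟩, ⟨U', hU'u⟩)
  -- the hypotheses (1.33), (1.34), (1.35) at (α, α)
  have hmul : mulCfg U' (1 : Site d → Fin d → 𝔸ˣ) = gaugeAct g 1 := by
    rw [B8Thm4Concrete.mulCfg_eq_mul, mul_one]
  have hInA : (zdGF3 𝔸 L β len i₀).InA α U₀ := B8Prop6OfThm4.one_inAk hL 1 one_pos hα _
  have hInAAx : (zdGF3 𝔸 L β len i₀).InAAx α U₀ P := by
    refine ⟨rfl, ?_, ?_⟩
    · show InAk L 1 1 α i₀.Ω (mulCfg U' 1)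
      rw [hmul]
      exact (B8Ineq132.inAk_gaugeAct_iff L 1 1 α i₀.Ω hg1 _).2 (B8Prop6OfThm4.one_inAk hL 1 one_pos hα _)
    · rintro m - j hj1 - xj ⟨-, hj0⟩
      omega
  have havg : (zdGF3 𝔸 L β len i₀).avgClose α U₀ P := by
    intro j _ z μ hbox
    exfalso
    have hLj : (1 : ℤ) ≤ (L : ℤ) ^ j := one_le_pow₀ (by exact_mod_cast hL)
    have hlo : InBox (loK L j z) (bondHiK L j z μ) (loK L j z) := fun i => by
      simp only [loK, bondHiK]; split_ifs <;> omega
    have hhi : InBox (loK L j z) (bondHiK L j z μ) (fun i => (L : ℤ) ^ j * z i + if i = μ then (L : ℤ) ^ j else 0) := fun i => by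
      simp only [loK, bondHiK]; split_ifs <;> omega
    obtain ⟨h₁, -⟩ := hbox _ hlo
    obtain ⟨h₂, -⟩ := hbox _ hhi
    have := congrArg (fun x : Site d => x μ) (h₂.trans h₁.symm)
    simp [loK] at this
    omega
  have hside : SideTouches (i₀.Ω 0) v μ₀ := by
    haveI : Nontrivial (Fin d) := Fin.nontrivial_iff_two_le.mpr hd2
    obtain ⟨κ, hκ⟩ := exists_ne μ₀
    exact B8Eq140Level.sideTouches_of_bondTouches hκ (Or.inl ⟨rfl, rfl⟩)
  -- for EVERY admissible `u`: the gauge-fixed bond variable at `(v, c)` is `−1`, so the (1.62)-clause at constant `B₁(α+α)` fails there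
  have key : ∀ w : Site d → 𝔸ˣ, w v = 1 → w (v + e μ₀) = 1 →
      ¬ ((mgauge (1 : Site d → Fin d → 𝔸ˣ) w⁻¹ U' v μ₀ =
            cfgExp 1 (logCfg 1 (mgauge (1 : Site d → Fin d → 𝔸ˣ) w⁻¹ U')) v μ₀) ∧
          ‖logCfg 1 (mgauge (1 : Site d → Fin d → 𝔸ˣ) w⁻¹ U') v μ₀‖ ≤ B₁ * (α + α) * ((L : ℝ) ^ 0 * 1)⁻¹) := by
    rintro w hwv hwc ⟨hexp, hbd⟩
    have hW : mgauge (1 : Site d → Fin d → 𝔸ˣ) w⁻¹ U' v μ₀ = -1 := by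
      simp only [mgauge_apply, Pi.inv_apply, Pi.one_apply, hwv, hwc, inv_one, one_mul, Rc_one_apply, mul_one, hU'vc]
    have hexp' : (((cfgExp 1 (logCfg 1 (mgauge (1 : Site d → Fin d → 𝔸ˣ) w⁻¹ U')) v μ₀ : 𝔸ˣ)) : 𝔸) = -1 := by
      rw [← hexp, hW, Units.val_neg, Units.val_one]
    have hbd' : ‖logCfg 1 (mgauge (1 : Site d → Fin d → 𝔸ˣ) w⁻¹ U') v μ₀‖ ≤ B₁ * (α + α) * (1 : ℝ)⁻¹ := by
      simpa only [pow_zero, one_mul] using hbd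
    have hsmall := norm_cfgExp_sub_one_le (d := d) one_pos hbd' hαB
    rw [hexp', norm_neg_one_sub_one'] at hsmall
    norm_num at hsmall
  -- Theorem 2's conclusion at this datum
  obtain ⟨u, hR, ⟨⟨h162, -, -⟩, -, -, -⟩, -⟩ := H i₀ α α hα hα hαc U₀ P hInA trivial hInAAx havg
  obtain ⟨hexp, -, hbd⟩ := h162 0 (Nat.zero_le _) (v, μ₀) hside
  have huv : u.1 v = 1 := Units.ext (restr129_level_zero hR (y := v) ⟨rfl, rfl⟩)
  have huc : u.1 (v + e μ₀) = 1 := by rw [hvc]; exact u.2.2 c fun h => hcv h.1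
  exact key u.1 huv huc ⟨hexp, hbd⟩

/-- **THEOREM 8's SURVIVING FORM is FALSE on the `GFData3` prototype `zdGF3` indexed by all of `ZdIdx`**, for every `γ > 0` and every `B₁, B₂`
(`d ≥ 2`, `L ≥ 1`): the same member/data with the source `f = 0` (`0 ∈ R(U₀)` by `B8Eq138LandauZd.inR138_zero`, `|0|₍₋₂₎ = 0 < γ(α₀ + α₁)`);
the surviving form asserts (1.62) `C162 B₁ (α₀ + α₁)` outright for `U′^{u⁻¹}`, which fails at the exterior-adjacent bond.
[cite: Balaban1985RegularSpaces, Thm 8 (1.146) p.101 (surviving form, GAPS G-B8-13), (1.62) p.87, p.77 («Ω_j = T_η» admitted)] -/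
theorem not_thm8SurvivingAt_zdGF3 (hd2 : 2 ≤ d) {L : ℕ} (hL : 1 ≤ L) (β : ℝ) (len : Site d → ℝ) {γ : ℝ} (hγ : 0 < γ) (B₁ B₂ : ℝ) :
    ¬ B8Thm8Surviving.Thm8SurvivingAt γ B₁ B₂ (fun i : ZdIdx d L => zdGF3 𝔸 L β len i) := by
  rintro ⟨c₁, hc₁, H⟩
  classical
  have hd0 : 0 < d := by omega
  set μ₀ : Fin d := ⟨0, hd0⟩ with hμ₀
  set v : Site d := 0 with hv
  set c : Site d := e μ₀ with hc
  have hcv : c ≠ v := by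
    intro h
    have := congrArg (fun x : Site d => x μ₀) h
    simp [hc, hv, e_apply] at this
  -- the minimal member
  let i₀ : ZdIdx d L :=
    { η := 1
      hη := one_pos
      k := 1
      hk := le_rfl
      Ω := fun j => {x | x = v ∧ j = 0}
      hΩ := fun j x hx => by simp at hx
      Λs := fun _ j => {x | x = v ∧ j = 0}
      Λb := fun _ _ => ∅
      hbox := fun m _ j _ c hc => by simp at hc
      hclass := fun m _ j _ c hc => by simp at hc
      htower := by
        rintro j - y ⟨rfl, rfl⟩ x hx
        refine ⟨funext fun i => le_antisymm (hx i).2 (hx i).1, rfl⟩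
      hpart := by
        rintro x ⟨rfl, -⟩
        exact ⟨0, Nat.zero_le _, v, ⟨rfl, rfl⟩, fun i => ⟨le_rfl, le_rfl⟩⟩ }
  -- the smallness parameters (`M = max B₁ 1` so that `B₁ ≤ 0` is covered too)
  set M : ℝ := max B₁ 1 with hM_def
  have hM : 0 < M := lt_of_lt_of_le one_pos (le_max_right _ _)
  set α : ℝ := min (c₁ / 2) (1 / (32 * M)) with hα_def
  have hα : 0 < α := lt_min (by linarith) (by positivity)
  have hαc : α + α ≤ c₁ := by
    have : α ≤ c₁ / 2 := min_le_left _ _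
    linarith
  have hαB : B₁ * (α + α) ≤ 1 / 16 := by
    have h1 : α ≤ 1 / (32 * M) := min_le_right _ _
    have h2 : M * α ≤ M * (1 / (32 * M)) := mul_le_mul_of_nonneg_left h1 hM.le
    have h3 : M * (1 / (32 * M)) = 1 / 32 := by field_simp
    have h4 : B₁ * (α + α) ≤ M * (α + α) := mul_le_mul_of_nonneg_right (le_max_left _ _) (by linarith)
    linarith
  -- the data: `U₀ = 1`, `U′` = pure gauge by `−1` at `c`
  set g : Site d → 𝔸ˣ := Function.update 1 c (-1) with hg_def
  have hgc : g c = -1 := by simp [hg_def]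
  have hgv : g v = 1 := by simp [hg_def, hcv.symm]
  have hgU : ∀ x, g x ∈ unitaryUnits 𝔸 := by
    intro x
    by_cases hx : x = c
    · rw [hx, hgc]; exact neg_one_mem_unitaryUnits'
    · rw [hg_def, Function.update_of_ne hx]; exact (unitaryUnits 𝔸).one_mem
  have hg1 : ∀ x, g x ∈ U1 𝔸 := fun x => unitaryUnits_le_U1 (hgU x)
  set U' : Site d → Fin d → 𝔸ˣ := gaugeAct g 1 with hU'_def
  have hU'u : ∀ x κ, U' x κ ∈ unitaryUnits 𝔸 := fun x κ =>
    (unitaryUnits 𝔸).mul_mem ((unitaryUnits 𝔸).mul_mem (hgU x) (unitaryUnits 𝔸).one_mem) ((unitaryUnits 𝔸).inv_mem (hgU _))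
  have hvc : v + e μ₀ = c := by simp [hv, hc]
  have hU'vc : U' v μ₀ = -1 := by
    simp only [hU'_def, gaugeAct, hvc, hgv, hgc, Pi.one_apply, one_mul, mul_one]
    exact inv_neg_one
  have h1u : ∀ x κ, (1 : Site d → Fin d → 𝔸ˣ) x κ ∈ unitaryUnits 𝔸 := fun _ _ => (unitaryUnits 𝔸).one_mem
  let U₀ : (zdGF3 𝔸 L β len i₀).Cfg := ⟨1, h1u⟩
  let P : (zdGF3 𝔸 L β len i₀).Pert := (⟨1, h1u⟩, ⟨U', hU'u⟩)
  -- the hypotheses (1.33), (1.34), (1.35) at (α, α)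
  have hmul : mulCfg U' (1 : Site d → Fin d → 𝔸ˣ) = gaugeAct g 1 := by
    rw [B8Thm4Concrete.mulCfg_eq_mul, mul_one]
  have hInA : (zdGF3 𝔸 L β len i₀).InA α U₀ := B8Prop6OfThm4.one_inAk hL 1 one_pos hα _
  have hInAAx : (zdGF3 𝔸 L β len i₀).InAAx α U₀ P := by
    refine ⟨rfl, ?_, ?_⟩
    · show InAk L 1 1 α i₀.Ω (mulCfg U' 1)
      rw [hmul]
      exact (B8Ineq132.inAk_gaugeAct_iff L 1 1 α i₀.Ω hg1 _).2 (B8Prop6OfThm4.one_inAk hL 1 one_pos hα _)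
    · rintro m - j hj1 - xj ⟨-, hj0⟩
      omega
  have havg : (zdGF3 𝔸 L β len i₀).avgClose α U₀ P := by
    intro j _ z μ hbox
    exfalso
    have hLj : (1 : ℤ) ≤ (L : ℤ) ^ j := one_le_pow₀ (by exact_mod_cast hL)
    have hlo : InBox (loK L j z) (bondHiK L j z μ) (loK L j z) := fun i => by
      simp only [loK, bondHiK]; split_ifs <;> omega
    have hhi : InBox (loK L j z) (bondHiK L j z μ) (fun i => (L : ℤ) ^ j * z i + if i = μ then (L : ℤ) ^ j else 0) := fun i => by
      simp only [loK, bondHiK]; split_ifs <;> omega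
    obtain ⟨h₁, -⟩ := hbox _ hlo
    obtain ⟨h₂, -⟩ := hbox _ hhi
    have := congrArg (fun x : Site d => x μ) (h₂.trans h₁.symm)
    simp [loK] at this
    omega
  have hside : SideTouches (i₀.Ω 0) v μ₀ := by
    haveI : Nontrivial (Fin d) := Fin.nontrivial_iff_two_le.mpr hd2
    obtain ⟨κ, hκ⟩ := exists_ne μ₀
    exact B8Eq140Level.sideTouches_of_bondTouches hκ (Or.inl ⟨rfl, rfl⟩)
  -- for EVERY admissible `u`: the gauge-fixed bond variable at `(v, c)` is `−1`, so the (1.62)-clause at constant `B₁(α+α)` fails there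
  have key : ∀ w : Site d → 𝔸ˣ, w v = 1 → w (v + e μ₀) = 1 →
      ¬ ((mgauge (1 : Site d → Fin d → 𝔸ˣ) w⁻¹ U' v μ₀ =
            cfgExp 1 (logCfg 1 (mgauge (1 : Site d → Fin d → 𝔸ˣ) w⁻¹ U')) v μ₀) ∧
          ‖logCfg 1 (mgauge (1 : Site d → Fin d → 𝔸ˣ) w⁻¹ U') v μ₀‖ ≤ B₁ * (α + α) * ((L : ℝ) ^ 0 * 1)⁻¹) := by
    rintro w hwv hwc ⟨hexp, hbd⟩
    have hW : mgauge (1 : Site d → Fin d → 𝔸ˣ) w⁻¹ U' v μ₀ = -1 := by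
      simp only [mgauge_apply, Pi.inv_apply, Pi.one_apply, hwv, hwc, inv_one, one_mul, Rc_one_apply, mul_one, hU'vc]
    have hexp' : (((cfgExp 1 (logCfg 1 (mgauge (1 : Site d → Fin d → 𝔸ˣ) w⁻¹ U')) v μ₀ : 𝔸ˣ)) : 𝔸) = -1 := by
      rw [← hexp, hW, Units.val_neg, Units.val_one]
    have hbd' : ‖logCfg 1 (mgauge (1 : Site d → Fin d → 𝔸ˣ) w⁻¹ U') v μ₀‖ ≤ B₁ * (α + α) * (1 : ℝ)⁻¹ := by
      simpa only [pow_zero, one_mul] using hbd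
    have hsmall := norm_cfgExp_sub_one_le (d := d) one_pos hbd' hαB
    rw [hexp', norm_neg_one_sub_one'] at hsmall
    norm_num at hsmall
  -- the source `f = 0`
  have hInR : (zdGF3 𝔸 L β len i₀).InR U₀ (0 : Site d → 𝔸) := inR138_zero (η := (1 : ℝ)) (U₀ := (1 : Site d → Fin d → 𝔸ˣ)) L 1 _ _
  have hfN : (zdGF3 𝔸 L β len i₀).fNorm (0 : Site d → 𝔸) < γ * (α + α) := by
    have h0 : (zdGF3 𝔸 L β len i₀).fNorm (0 : Site d → 𝔸) ≤ 0 :=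
      B8ScaledSupNorm.msup_le le_rfl fun j _ x _ => by simp
    have : 0 < γ * (α + α) := by positivity
    linarith
  -- Theorem 8's (surviving) conclusion at this datum: (1.62) outright
  obtain ⟨u, hR, ⟨h162, -, -, -⟩, -⟩ := H i₀ α α hα hα hαc U₀ P (0 : Site d → 𝔸) hInA trivial hInAAx havg hInR hfN
  obtain ⟨hexp, -, hbd⟩ := h162 0 (Nat.zero_le _) (v, μ₀) hside
  have huv : u.1 v = 1 := Units.ext (restr129_level_zero hR (y := v) ⟨rfl, rfl⟩)
  have huc : u.1 (v + e μ₀) = 1 := by rw [hvc]; exact u.2.2 c fun h => hcv h.1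
  exact key u.1 huv huc ⟨hexp, hbd⟩

end Refutation

#print axioms not_thm2Printed_zdGF3
#print axioms not_thm8SurvivingAt_zdGF3

end Literature.MathematicalPhysics.QuantumFieldTheory.Balaban1983to89.B8LeafModelZd3Boundary

end
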